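import Summits.MatrixMultiplication.MatrixMultiplication.Theorems.OutsiderSandwichCancellingPair
import Summits.MatrixMultiplication.MatrixMultiplication.Theorems.OutsiderSandwichBorderFloor
import Summits.MatrixMultiplication.MatrixMultiplication.Theorems.OutsiderSandwichLevelOne
import HarnessLib

/-!
# The amortised BORDER exchange table `a̲(N, m)` and its ladder to `BlockOneIsMM`

Route `OutsiderSandwich` (decomposition cell `decomp-mm`, lens 4 «minimal counterexample /
extremal reduction», gen 29), support for the aside leaf `BlockOneIsMM`
(stmt-MatrixMultiplication-27147).

`AmortisedDeg N B m` : `⟨B⟩ ⊠ C₁^{⊠N} ⊵_deg ⟨m⟩ ⊠ ⟨2,2,2⟩^{⊠N}` — `B` coupled blocks DEGENERATE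
(BCS (15.19)) to `m` independent products; `a̲(N, m) = borderAmortisedNumber N m` is the least
such `B`.  It sits below the restriction table `a(N, m)` (`OutsiderSandwichAmortisedTable`) and
above the coupled-slice floor (`OutsiderSandwichBorderFloor`), and — unlike restriction — it
ATTAINS the floor at level one:

* calculus: `of_amortised`, `mono`, `anti`, `add`, `smul` (direct sums of degenerations,
  BCS (15.25), restated for `ℂ` at unequal orders), `amortisedDeg_one_iff` (`m = 1` is `HelpedDeg`);
* **level-one row** `borderAmortisedNumber_one : a̲(1, m) = ⌈4m/3⌉` (upper: cancelling pairs
  `⟨4⟩ ⊠ C₁ ⊵ ⟨3⟩ ⊠ ⟨2,2,2⟩` plus one restriction block; lower: `border_level_one_floor`),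
  against `a(1, m) = ⌈3m/2⌉` (`OutsiderSandwichLevelOne.amortisedNumber_one`):
  `a̲(1,3) = 4 < 5 = a(1,3)`, and `a̲(1,m) < a(1,m)` iff `m = 3 ∨ m ≥ 5`;
* **the ladder**: `BorderSaturated n` := the level-`(n+1)` floor is attained,
  `⟨2^{n+2}⟩ ⊠ C₁^{⊠(n+1)} ⊵ ⟨2^{n+2} − 1⟩ ⊠ ⟨2,2,2⟩^{⊠(n+1)}`; rung `0` is the cancelling pair;
  each rung gives `θ⋆ ≤ 1/(n+1)`, so `(∀ n, BorderSaturated n) → BlockOneIsMM`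
  (`blockOneIsMM_of_forall_borderSaturated`); rung `1` is the finite test
  `⟨8⟩ ⊠ C₁^{⊠2} ⊵ ⟨7⟩ ⊠ ⟨2,2,2⟩^{⊠2}` (open); any level-two border certificate with
  `B/m < 2^{0.7459}` would be a `θ⋆` record; `blockOneIsMM_iff_amortisedDeg` is the leaf in
  table form.

## References
* P. Bürgisser, M. Clausen, M. A. Shokrollahi, *Algebraic Complexity Theory*, Springer 1997,
  (15.19)–(15.26), Lemma (15.24), Prop. (15.25). [BurgisserClausenShokrollahi1997]
* D. Coppersmith, S. Winograd, *Matrix multiplication via arithmetic progressions*,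
  J. Symbolic Comput. 9 (1990) 251–280, §7. [CoppersmithWinograd1990]
* V. Strassen, *The asymptotic spectrum of tensors*, J. reine angew. Math. 384 (1988)
  102–152, Thm. 3.8. [Strassen1988]
* D. Bini, *Relations between exact and approximate bilinear algorithms. Applications*,
  Calcolo 17 (1980) 87–97. [Bini1980]
-/

noncomputable section

open scoped BigOperators Polynomial

set_option linter.dupNamespace false
set_option autoImplicit false

namespace Summit.MatrixMultiplication.MatrixMultiplication.Theorems.OutsiderSandwichBorderTable

open Polynomial (C X)
open Literature.Computability.AlgebraicComplexity
open Summit.MatrixMultiplication.MatrixMultiplication.Theorems.OutsiderSandwichCoupling (coupling₁)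
open Summit.MatrixMultiplication.MatrixMultiplication.Theorems.OutsiderSandwichAmortised
  (mk_unit_kronecker_pow exchangeExponent_le_of_amortised)
open Summit.MatrixMultiplication.MatrixMultiplication.Theorems.OutsiderSandwichBorderExchange
  (restrictsTo_of_mk_eq HelpedDeg HelpedDegBy)
open Summit.MatrixMultiplication.MatrixMultiplication.Theorems.OutsiderSandwichExchangeExponent
  (exchangeExponent exchangeExponent_nonneg blockOneIsMM_iff_exchangeExponent_eq_zero)
open Summit.MatrixMultiplication.MatrixMultiplication.Theorems.OutsiderSandwichAmortisedTable
  (Amortised amortisedNumber amortised_amortisedNumber amortisedNumber_le amortised_mul_two_pow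
    amortised_one_three_two amortised_zero amortised_one_iff)
open Summit.MatrixMultiplication.MatrixMultiplication.Theorems.OutsiderSandwichLevelOne
  (amortisedNumber_one amortisedNumber_one_three_eq)
open Summit.MatrixMultiplication.MatrixMultiplication.Theorems.OutsiderSandwichExchangeRate
  (helped_one_two)
open Summit.MatrixMultiplication.MatrixMultiplication.Theorems.OutsiderSandwichCancellingPair
  (amortisedDeg_one_four_three isApproxRestriction_directSum_same)
open Summit.MatrixMultiplication.MatrixMultiplication.Theorems.OutsiderSandwichBorderFloor
  (border_floor border_level_one_floor)

/-! ## 1. Direct sums of degenerations of unequal orders (BCS (15.24), for `ℂ`) -/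

/-- BCS (15.24)(1): raise the order by one (third matrix times `X`).
[cite: BurgisserClausenShokrollahi1997, Lemma (15.24)(1)] -/
theorem isApproxRestriction_order_succ {ι κ μ ι' κ' μ' : Type} [Fintype ι] [Fintype κ] [Fintype μ]
    {h : ℕ} {s : ι → κ → μ → ℂ} {t : ι' → κ' → μ' → ℂ} {A : ι' → ι → ℂ[X]} {B : κ' → κ → ℂ[X]}
    {D : μ' → μ → ℂ[X]} (hr : IsApproxRestriction h s t A B D) :
    IsApproxRestriction (h + 1) s t A B (fun c' c => X * D c' c) := by
  intro a' b' c' j hj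
  have e : (∑ a, ∑ b, ∑ c, A a' a * B b' b * (X * D c' c) * Polynomial.C (s a b c)) =
      X * ∑ a, ∑ b, ∑ c, A a' a * B b' b * D c' c * Polynomial.C (s a b c) := by
    rw [Finset.mul_sum]
    refine Finset.sum_congr rfl fun a _ => ?_
    rw [Finset.mul_sum]
    refine Finset.sum_congr rfl fun b _ => ?_
    rw [Finset.mul_sum]
    exact Finset.sum_congr rfl fun c _ => by ring
  rw [e]
  rcases j with _ | j
  · rw [Polynomial.coeff_X_mul_zero]
    simp
  · rw [Polynomial.coeff_X_mul, hr a' b' c' j (by omega)]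
    by_cases hjh : j = h
    · subst hjh; simp
    · rw [if_neg hjh, if_neg (by omega)]

/-- BCS (15.24)(1) iterated: raise the order by `k`.
[cite: BurgisserClausenShokrollahi1997, Lemma (15.24)(1)] -/
theorem isApproxRestriction_order_add {ι κ μ ι' κ' μ' : Type} [Fintype ι] [Fintype κ] [Fintype μ]
    {h : ℕ} {s : ι → κ → μ → ℂ} {t : ι' → κ' → μ' → ℂ} {A : ι' → ι → ℂ[X]} {B : κ' → κ → ℂ[X]}
    {D : μ' → μ → ℂ[X]} (hr : IsApproxRestriction h s t A B D) (k : ℕ) :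
    IsApproxRestriction (h + k) s t A B (fun c' c => X ^ k * D c' c) := by
  induction k with
  | zero => simpa using hr
  | succ k ih =>
    have h' := isApproxRestriction_order_succ ih
    have e : (fun c' c => X * (X ^ k * D c' c)) = fun c' c => X ^ (k + 1) * D c' c := by
      funext c' c; ring
    rw [e] at h'
    simpa [Nat.add_assoc] using h'

/-- **Degeneration is compatible with direct sums** (BCS Prop. (15.25), for `ℂ`-tensors on `Type`).
[cite: BurgisserClausenShokrollahi1997, Prop. (15.25)] -/
theorem algDegeneratesTo_directSum {ι κ μ ι' κ' μ' ι₁ κ₁ μ₁ ι₁' κ₁' μ₁' : Type}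
    [Fintype ι] [Fintype κ] [Fintype μ] [Fintype ι₁] [Fintype κ₁] [Fintype μ₁]
    {s : ι → κ → μ → ℂ} {t : ι' → κ' → μ' → ℂ} {s₁ : ι₁ → κ₁ → μ₁ → ℂ} {t₁ : ι₁' → κ₁' → μ₁' → ℂ}
    (hd : AlgDegeneratesTo s t) (hd₁ : AlgDegeneratesTo s₁ t₁) :
    AlgDegeneratesTo (directSumTensor s s₁) (directSumTensor t t₁) := by
  obtain ⟨h, A, B, D, hr⟩ := hd
  obtain ⟨h₁, A₁, B₁, D₁, hr₁⟩ := hd₁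
  have h2 : IsApproxRestriction (h + h₁) s₁ t₁ A₁ B₁ (fun c' c => X ^ h * D₁ c' c) := by
    rw [Nat.add_comm]; exact isApproxRestriction_order_add hr₁ h
  exact ⟨h + h₁, _, _, _,
    isApproxRestriction_directSum_same (isApproxRestriction_order_add hr h₁) h2⟩

/-! ## 2. The amortised border table -/

/-- **`AmortisedDeg N B m`** (problem-side definition): `⟨B⟩ ⊠ C₁^{⊠N} ⊵_deg ⟨m⟩ ⊠ ⟨2,2,2⟩^{⊠N}` —
`B` coupled blocks at level `N` DEGENERATE (BCS (15.19)) to `m` independent products of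
`2^N × 2^N` matrices; the border analogue of `OutsiderSandwichAmortisedTable.Amortised`. -/
def AmortisedDeg (N B m : ℕ) : Prop :=
  AlgDegeneratesTo (kroneckerTensor (unitTensor ℂ B) (kroneckerPow coupling₁ N))
    (kroneckerTensor (unitTensor ℂ m) (kroneckerPow (matMulTensor ℂ 2 2 2) N))

/-- A restriction certificate is a border certificate (BCS (15.20)).
[cite: BurgisserClausenShokrollahi1997, (15.20)] -/
theorem AmortisedDeg.of_amortised {N B m : ℕ} (h : Amortised N B m) : AmortisedDeg N B m :=
  TensorRestrictsTo.algDegeneratesTo h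

/-- `⟨B'⟩ ⊠ t^{⊠N} ≥ ⟨B⟩ ⊠ t^{⊠N}` for `B ≤ B'`. [cite: Zuiddam2018, §2.3] -/
theorem unit_kronecker_restrictsTo_of_le {ι κ μ : Type} [Fintype ι] [Fintype κ] [Fintype μ]
    [DecidableEq ι] [DecidableEq κ] [DecidableEq μ] (t : ι → κ → μ → ℂ) (N : ℕ) {B B' : ℕ}
    (hB : B ≤ B') :
    TensorRestrictsTo (kroneckerTensor (unitTensor ℂ B') (kroneckerPow t N))
      (kroneckerTensor (unitTensor ℂ B) (kroneckerPow t N)) := by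
  rw [← TensorClass.mk_le_mk_iff, mk_unit_kronecker_pow, mk_unit_kronecker_pow]
  exact TensorClass.mul_le_mul (TensorClass.natCast_le_natCast_iff.2 hB) le_rfl

/-- `[(⟨B⟩ ⊠ t^{⊠N}) ⊕ (⟨B'⟩ ⊠ t^{⊠N})] = [⟨B + B'⟩ ⊠ t^{⊠N}]` in `T(ℂ)`. [cite: Zuiddam2018, §2.3] -/
theorem mk_directSum_unit_kronecker {ι κ μ : Type} [Fintype ι] [Fintype κ] [Fintype μ]
    [DecidableEq ι] [DecidableEq κ] [DecidableEq μ] (t : ι → κ → μ → ℂ) (N B B' : ℕ) :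
    TensorClass.mk (directSumTensor (kroneckerTensor (unitTensor ℂ B) (kroneckerPow t N))
        (kroneckerTensor (unitTensor ℂ B') (kroneckerPow t N))) =
      TensorClass.mk (kroneckerTensor (unitTensor ℂ (B + B')) (kroneckerPow t N)) := by
  rw [← TensorClass.mk_add_mk, mk_unit_kronecker_pow, mk_unit_kronecker_pow,
    mk_unit_kronecker_pow]
  push_cast
  ring

/-- Monotone in the budget. [folklore] -/
theorem AmortisedDeg.mono {N B B' m : ℕ} (h : AmortisedDeg N B m) (hB : B ≤ B') :
    AmortisedDeg N B' m :=
  (unit_kronecker_restrictsTo_of_le coupling₁ N hB).algDegeneratesTo_trans h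

/-- Antitone in the number of products. [folklore] -/
theorem AmortisedDeg.anti {N B m m' : ℕ} (h : AmortisedDeg N B m) (hm : m' ≤ m) :
    AmortisedDeg N B m' :=
  h.trans_restrictsTo (unit_kronecker_restrictsTo_of_le (matMulTensor ℂ 2 2 2) N hm)

/-- **Additivity** (direct sums of degenerations, BCS (15.25)). [cite: BurgisserClausenShokrollahi1997, Prop. (15.25)] -/
theorem AmortisedDeg.add {N B B' m m' : ℕ} (h : AmortisedDeg N B m) (h' : AmortisedDeg N B' m') :
    AmortisedDeg N (B + B') (m + m') :=
  ((restrictsTo_of_mk_eq (mk_directSum_unit_kronecker coupling₁ N B B')).algDegeneratesTo_trans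
    (algDegeneratesTo_directSum h h')).trans_restrictsTo
    (restrictsTo_of_mk_eq (mk_directSum_unit_kronecker (matMulTensor ℂ 2 2 2) N m m').symm)

/-- Zero products need nothing. [folklore] -/
theorem amortisedDeg_zero (N B : ℕ) : AmortisedDeg N B 0 :=
  AmortisedDeg.of_amortised (amortised_zero N B)

/-- Scaling. [folklore] -/
theorem AmortisedDeg.smul {N B m : ℕ} (h : AmortisedDeg N B m) (k : ℕ) :
    AmortisedDeg N (k * B) (k * m) := by
  induction k with
  | zero => simpa using amortisedDeg_zero N 0
  | succ k ih =>
    have := ih.add h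
    simpa [Nat.succ_mul] using this

/-- Multiplicity one is `HelpedDeg`. [cite: CoppersmithWinograd1990, §7] -/
theorem amortisedDeg_one_iff (N B : ℕ) : AmortisedDeg N B 1 ↔ HelpedDeg N B := by
  have e : TensorClass.mk (kroneckerTensor (unitTensor ℂ 1) (kroneckerPow (matMulTensor ℂ 2 2 2) N)) =
      TensorClass.mk (kroneckerPow (matMulTensor ℂ 2 2 2) N) := by
    rw [mk_unit_kronecker_pow, TensorClass.mk_pow, Nat.cast_one, one_mul]
  constructor
  · intro h
    exact h.trans_restrictsTo (restrictsTo_of_mk_eq e.symm)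
  · intro h
    exact AlgDegeneratesTo.trans_restrictsTo h (restrictsTo_of_mk_eq e)

/-- The set of border budgets is nonempty (`m · 2^N` works by restriction). [folklore] -/
theorem amortisedDeg_mul_two_pow (N m : ℕ) : AmortisedDeg N (m * 2 ^ N) m :=
  AmortisedDeg.of_amortised (amortised_mul_two_pow N m)

/-- **`a̲(N, m)`** (problem-side definition) — the amortised BORDER exchange number: the least `B`
with `⟨B⟩ ⊠ C₁^{⊠N} ⊵_deg ⟨m⟩ ⊠ ⟨2,2,2⟩^{⊠N}`. -/
def borderAmortisedNumber (N m : ℕ) : ℕ :=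
  sInf {B : ℕ | AmortisedDeg N B m}

/-- `a̲(N, m)` is attained. [folklore] -/
theorem amortisedDeg_borderAmortisedNumber (N m : ℕ) :
    AmortisedDeg N (borderAmortisedNumber N m) m :=
  Nat.sInf_mem (s := {B : ℕ | AmortisedDeg N B m}) ⟨m * 2 ^ N, amortisedDeg_mul_two_pow N m⟩

/-- `a̲(N, m) ≤ B` for every border certificate. [folklore] -/
theorem borderAmortisedNumber_le {N B m : ℕ} (h : AmortisedDeg N B m) :
    borderAmortisedNumber N m ≤ B :=
  Nat.sInf_le h

/-- `AmortisedDeg N B m ↔ a̲(N, m) ≤ B`. [folklore] -/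
theorem amortisedDeg_iff_le {N B m : ℕ} : AmortisedDeg N B m ↔ borderAmortisedNumber N m ≤ B :=
  ⟨borderAmortisedNumber_le, fun h => (amortisedDeg_borderAmortisedNumber N m).mono h⟩

/-- **`a̲(N, m) ≤ a(N, m)`**: the border table sits below the restriction table. [cite: Bini1980, §2] -/
theorem borderAmortisedNumber_le_amortisedNumber (N m : ℕ) :
    borderAmortisedNumber N m ≤ amortisedNumber N m :=
  borderAmortisedNumber_le (AmortisedDeg.of_amortised (amortised_amortisedNumber N m))

/-- **The coupled-slice floor under degeneration**: `m·4^{n+1} + a̲·2^n ≤ a̲·4^{n+1}`.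
[cite: CoppersmithWinograd1990, §7] -/
theorem borderAmortisedNumber_floor (n m : ℕ) :
    m * 4 ^ (n + 1) + borderAmortisedNumber (n + 1) m * 2 ^ n ≤
      borderAmortisedNumber (n + 1) m * 4 ^ (n + 1) :=
  border_floor (amortisedDeg_borderAmortisedNumber (n + 1) m)

/-! ## 3. The level-one row: `a̲(1, m) = ⌈4m/3⌉` -/

/-- `a̲(1, 3k) ≤ 4k`: `k` cancelling pairs. [new] -/
theorem amortisedDeg_one_mul (k : ℕ) : AmortisedDeg 1 (k * 4) (k * 3) :=
  AmortisedDeg.smul amortisedDeg_one_four_three k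

/-- `a̲(1, 3k+1) ≤ 4k+2`: `k` cancelling pairs and one `2 → 1` restriction block. [new] -/
theorem amortisedDeg_one_mul_add_one (k : ℕ) : AmortisedDeg 1 (k * 4 + 2) (k * 3 + 1) :=
  (amortisedDeg_one_mul k).add (AmortisedDeg.of_amortised ((amortised_one_iff 1 2).2 helped_one_two))

/-- `a̲(1, 3k+2) ≤ 4k+3`: `k` cancelling pairs and one `3 → 2` restriction block. [new] -/
theorem amortisedDeg_one_mul_add_two (k : ℕ) : AmortisedDeg 1 (k * 4 + 3) (k * 3 + 2) :=
  (amortisedDeg_one_mul k).add (AmortisedDeg.of_amortised amortised_one_three_two)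

/-- **Upper bound `a̲(1, m) ≤ ⌈4m/3⌉`.** [new] -/
theorem amortisedDeg_one_ceil (m : ℕ) : AmortisedDeg 1 ((4 * m + 2) / 3) m := by
  obtain ⟨k, r, hr, rfl⟩ : ∃ k r, r < 3 ∧ m = k * 3 + r :=
    ⟨m / 3, m % 3, Nat.mod_lt _ (by norm_num), by omega⟩
  interval_cases r
  · have e : (4 * (k * 3 + 0) + 2) / 3 = k * 4 := by omega
    rw [e]; simpa using amortisedDeg_one_mul k
  · have e : (4 * (k * 3 + 1) + 2) / 3 = k * 4 + 2 := by omega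
    rw [e]; exact amortisedDeg_one_mul_add_one k
  · have e : (4 * (k * 3 + 2) + 2) / 3 = k * 4 + 3 := by omega
    rw [e]; exact amortisedDeg_one_mul_add_two k

/-- **Lower bound `⌈4m/3⌉ ≤ B`** for every level-one border certificate (border-closed floor).
[cite: CoppersmithWinograd1990, §7] -/
theorem ceil_le_of_amortisedDeg_one {B m : ℕ} (h : AmortisedDeg 1 B m) : (4 * m + 2) / 3 ≤ B := by
  have := border_level_one_floor h
  omega

/-- **The level-one row of the border table: `a̲(1, m) = ⌈4m/3⌉`** (restriction: `a(1, m) = ⌈3m/2⌉`).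
[new] -/
theorem borderAmortisedNumber_one (m : ℕ) : borderAmortisedNumber 1 m = (4 * m + 2) / 3 :=
  le_antisymm (borderAmortisedNumber_le (amortisedDeg_one_ceil m))
    (ceil_le_of_amortisedDeg_one (amortisedDeg_borderAmortisedNumber 1 m))

/-- The level-one row decided: `AmortisedDeg 1 B m ↔ 4m ≤ 3B`. [new] -/
theorem amortisedDeg_one_iff_le (B m : ℕ) : AmortisedDeg 1 B m ↔ 4 * m ≤ 3 * B := by
  rw [amortisedDeg_iff_le, borderAmortisedNumber_one]
  omega

/-- **`a̲(1, 3) = 4 < 5 = a(1, 3)`**: four coupled blocks degenerate to three products but do not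
restrict to them — the first entry where the border table is strictly below the restriction table.
[new] -/
theorem borderAmortisedNumber_one_three :
    borderAmortisedNumber 1 3 = 4 ∧ amortisedNumber 1 3 = 5 :=
  ⟨borderAmortisedNumber_one 3, amortisedNumber_one_three_eq⟩

/-- `a̲(1, m) < a(1, m)` exactly for `m = 3` and all `m ≥ 5` (ties at `m ∈ {0, 1, 2, 4}`). [new] -/
theorem borderAmortisedNumber_one_lt_iff (m : ℕ) :
    borderAmortisedNumber 1 m < amortisedNumber 1 m ↔ m = 3 ∨ 5 ≤ m := by
  rw [borderAmortisedNumber_one, amortisedNumber_one]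
  omega

/-! ## 4. The ladder: saturated levels and the leaf -/

/-- **Exponent bound from a border-table entry**: `θ⋆ ≤ log₂(B/m)/N`. [cite: Strassen1988, Thm. 3.8] -/
theorem exchangeExponent_le_of_amortisedDeg {N B m : ℕ} (hN : 0 < N) (hm : 0 < m)
    (h : AmortisedDeg N B m) : exchangeExponent ≤ Real.logb 2 ((B : ℝ) / m) / N :=
  exchangeExponent_le_of_amortised hN hm h

/-- A border certificate of ratio at most `2` at level `N` gives `θ⋆ ≤ 1/N`. [cite: Strassen1988, Thm. 3.8] -/
theorem exchangeExponent_le_inv_of_ratio_le_two {N B m : ℕ} (hN : 0 < N) (hm : 0 < m)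
    (h : AmortisedDeg N B m) (hBm : B ≤ 2 * m) : exchangeExponent ≤ 1 / (N : ℝ) := by
  have h1 := exchangeExponent_le_of_amortisedDeg hN hm h
  have hm' : (0 : ℝ) < m := by exact_mod_cast hm
  have hratio : (B : ℝ) / m ≤ 2 := by
    rw [div_le_iff₀ hm']
    exact_mod_cast hBm
  have hlog : Real.logb 2 ((B : ℝ) / m) ≤ 1 := by
    rcases Nat.eq_zero_or_pos B with rfl | hB
    · simp
    · have hpos : (0 : ℝ) < (B : ℝ) / m := div_pos (by exact_mod_cast hB) hm'
      calc Real.logb 2 ((B : ℝ) / m) ≤ Real.logb 2 2 :=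
            Real.logb_le_logb_of_le (by norm_num) hpos hratio
        _ = 1 := Real.logb_self_eq_one (by norm_num)
  have hN' : (0 : ℝ) < N := by exact_mod_cast hN
  calc exchangeExponent ≤ Real.logb 2 ((B : ℝ) / m) / N := h1
    _ ≤ 1 / (N : ℝ) := div_le_div_of_nonneg_right hlog hN'.le

/-- **`BorderSaturated n`** (problem-side definition): the level-`(n+1)` coupled-slice floor
`m·4^{n+1} + B·2^n ≤ B·4^{n+1}` is ATTAINED, by `B = 2^{n+2}`, `m = 2^{n+2} − 1`:
`⟨2^{n+2}⟩ ⊠ C₁^{⊠(n+1)} ⊵_deg ⟨2^{n+2} − 1⟩ ⊠ ⟨2,2,2⟩^{⊠(n+1)}`. -/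
def BorderSaturated (n : ℕ) : Prop :=
  AmortisedDeg (n + 1) (2 ^ (n + 2)) (2 ^ (n + 2) - 1)

/-- The saturating pair is exactly on the floor: `m·4^{n+1} + B·2^n = B·4^{n+1}`. [new] -/
theorem saturating_pair_on_floor (n : ℕ) :
    (2 ^ (n + 2) - 1) * 4 ^ (n + 1) + 2 ^ (n + 2) * 2 ^ n = 2 ^ (n + 2) * 4 ^ (n + 1) := by
  have h4 : (4 : ℕ) ^ (n + 1) = 2 ^ (n + 2) * 2 ^ n := by
    rw [show (4 : ℕ) = 2 ^ 2 by norm_num, ← pow_mul, ← pow_add]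
    congr 1
    ring
  obtain ⟨a, ha⟩ : ∃ a : ℕ, 2 ^ (n + 2) = a + 1 :=
    ⟨2 ^ (n + 2) - 1, by have := Nat.one_le_two_pow (n := n + 2); omega⟩
  rw [h4, ha, Nat.add_sub_cancel]
  ring

/-- **Rung 0 holds**: `⟨4⟩ ⊠ C₁ ⊵ ⟨3⟩ ⊠ ⟨2,2,2⟩` (the cancelling pair). [new] -/
theorem borderSaturated_zero : BorderSaturated 0 :=
  amortisedDeg_one_four_three

/-- Each rung bounds the exponent: `BorderSaturated n → θ⋆ ≤ 1/(n+1)`. [cite: Strassen1988, Thm. 3.8] -/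
theorem exchangeExponent_le_of_borderSaturated {n : ℕ} (h : BorderSaturated n) :
    exchangeExponent ≤ 1 / ((n + 1 : ℕ) : ℝ) := by
  have h1 : 1 ≤ 2 ^ (n + 2) := Nat.one_le_two_pow
  have h4 : 4 ≤ 2 ^ (n + 2) := by
    calc (4 : ℕ) = 2 ^ 2 := by norm_num
      _ ≤ 2 ^ (n + 2) := Nat.pow_le_pow_right (by norm_num) (by omega)
  exact exchangeExponent_le_inv_of_ratio_le_two (Nat.succ_pos n) (by omega) h (by omega)

/-- **The ladder reaches the leaf**: if every level is saturated then `θ⋆ = 0`, i.e.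
`BlockOneIsMM`. [new] -/
theorem blockOneIsMM_of_forall_borderSaturated (h : ∀ n : ℕ, BorderSaturated n) :
    Theses.OutsiderSandwich.BlockOneIsMM := by
  rw [blockOneIsMM_iff_exchangeExponent_eq_zero]
  refine le_antisymm ?_ exchangeExponent_nonneg
  refine le_of_forall_pos_le_add fun δ hδ => ?_
  obtain ⟨n, hn⟩ := exists_nat_one_div_lt hδ
  have := exchangeExponent_le_of_borderSaturated (h n)
  push_cast at this
  linarith

/-- **The leaf in border-table form**: `BlockOneIsMM ↔ ∀ θ > 0, ∃ N ≥ 1, ∃ B m ≥ 1` with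
`⟨B⟩ ⊠ C₁^{⊠N} ⊵_deg ⟨m⟩ ⊠ ⟨2,2,2⟩^{⊠N}` and `B ≤ m · 2^{θN}`. [new] -/
theorem blockOneIsMM_iff_amortisedDeg :
    Theses.OutsiderSandwich.BlockOneIsMM ↔
      ∀ θ : ℝ, 0 < θ → ∃ N : ℕ, 1 ≤ N ∧ ∃ B m : ℕ, 1 ≤ m ∧ AmortisedDeg N B m ∧
        (B : ℝ) ≤ m * (2 : ℝ) ^ (θ * N) := by
  constructor
  · intro hleaf θ hθ
    obtain ⟨N, hN, m, hm, hle⟩ :=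
      (OutsiderSandwichAmortisedLaws.blockOneIsMM_iff_amortised.1 hleaf) θ hθ
    exact ⟨N, hN, amortisedNumber N m, m, hm,
      AmortisedDeg.of_amortised (amortised_amortisedNumber N m), hle⟩
  · intro h
    rw [blockOneIsMM_iff_exchangeExponent_eq_zero]
    refine le_antisymm ?_ exchangeExponent_nonneg
    refine le_of_forall_pos_le_add fun δ hδ => ?_
    obtain ⟨N, hN, B, m, hm, hdeg, hle⟩ := h δ hδ
    have hm' : (0 : ℝ) < m := by exact_mod_cast hm
    have hN' : (0 : ℝ) < N := by exact_mod_cast hN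
    have h1 := exchangeExponent_le_of_amortisedDeg hN hm hdeg
    have hratio : (B : ℝ) / m ≤ (2 : ℝ) ^ (δ * N) := by
      rw [div_le_iff₀ hm']; linarith [hle]
    have hlog : Real.logb 2 ((B : ℝ) / m) ≤ δ * N := by
      rcases Nat.eq_zero_or_pos B with rfl | hB
      · simp; positivity
      · have hpos : (0 : ℝ) < (B : ℝ) / m := div_pos (by exact_mod_cast hB) hm'
        calc Real.logb 2 ((B : ℝ) / m) ≤ Real.logb 2 ((2 : ℝ) ^ (δ * N)) :=
              Real.logb_le_logb_of_le (by norm_num) hpos hratio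
          _ = δ * N := Real.logb_rpow (by norm_num) (by norm_num)
    have h2 : Real.logb 2 ((B : ℝ) / m) / N ≤ δ := by
      rw [div_le_iff₀ hN']; exact hlog
    linarith

end Summit.MatrixMultiplication.MatrixMultiplication.Theorems.OutsiderSandwichBorderTable
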